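import Summits.BirchSwinnertonDyer.Rank1Residual.X2.TwistTamagawa
import Literature.NumberTheory.EllipticCurves.ManinConstantQuadraticTwistStevensHoldsProofs
import HarnessLib

/-!
# Route `CMKolyvaginAtInertTwo`, crux `CMKolyvaginExactAtInertTwo` (stmt-BirchSwinnertonDyer-24277):
# THE COUNT IDENTITY `#Ш(E/K)[2^∞] = #Ш(E/ℚ)[2^∞] · #Ш(E^{(d_K)}/ℚ)[2^∞]`, VI — the globally
# minimal model of the Heegner twist with unit scaling (`|u_d| = 1`) on a prime Heegner field

Seat `bsd-line-cmk2-p1` g15 (cell `bsd-print-cf2`); helper (`--supports stmt-BirchSwinnertonDyer-24277`).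
THEOREMS ONLY: no definition, no named fact, no `sorry`; no item is closed; BSD is not proved by this.

Files IV/V take a globally minimal model `Wd = Cd • W^{(d_K)}` of the twist with `|u(Cd)| = 1`
(so that the period of Milne's quotient needs no correction at `2`). On a prime Heegner field
`K = ℚ(√−q)` (`d_K = −q`, `q ≡ 3 (mod 4)` an odd prime, `q ∤ N`) such a model is the integral twist
model by `q* = −q = d_K` of the tree (`WeierstrassCurve.twistModel k`, `4k + 1 = d_K`): globally
minimal by `isGloballyMinimal_twistModel_pStar` (good reduction of `W` at `q`; Stevens 1989 Lemma
5.2 sketch / Comalada 1994), and isomorphic to `W^{(d_K)}` by completing the square with `u = 1`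
(`exists_variableChange_twistModel_eq_quadraticTwist`).

* `discr_eq_neg_natAbs`, `natAbs_discr_mod_four` — `d_K = −q`, `q ≡ 3 (mod 4)` for an imaginary
  quadratic field with odd `d_K`;
* `pStar_natAbs_discr_eq` — `q* = (−1)^{(q−1)/2} q = d_K`;
* `exists_isGloballyMinimal_twist_of_prime_discr` — **∃ `Wd`, `Cd` with `Cd • W^{(d_K)} = Wd`,
  `|u(Cd)| = 1`, `Wd` elliptic and globally minimal**.

References: Stevens 1989 Lemma (5.2); Silverman *AEC* VII.1, X.5 Cor. 5.4; Gross 1991 §2.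
-/

-- single-conjunct summit: `Summit.BirchSwinnertonDyer.BirchSwinnertonDyer.…` repeats the name by design
set_option linter.dupNamespace false
set_option autoImplicit false

noncomputable section

open scoped Classical

open WeierstrassCurve NumberField Literature.NumberTheory.EllipticCurves
  Literature.NumberTheory.EllipticCurves.ModularForms Literature.NumberTheory.QuadraticFields
  Literature.NumberTheory.EllipticCurves.Rank1Residual Summit.BirchSwinnertonDyer.Rank1Residual

namespace Summit.BirchSwinnertonDyer.BirchSwinnertonDyer.Theorems.ShaCountTwo

section Discr

variable (K : Type) [Field K] [NumberField K] (hK : IsImaginaryQuadratic K)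
  (hodd : Odd (NumberField.discr K))

include hK in
/-- `d_K = −|d_K|` for an imaginary quadratic field. [folklore] -/
theorem discr_eq_neg_natAbs : NumberField.discr K = -((NumberField.discr K).natAbs : ℤ) := by
  have hneg : NumberField.discr K < 0 := hK.discr_neg
  rw [Int.ofNat_natAbs_of_nonpos hneg.le, neg_neg]

include hK hodd in
/-- `|d_K| ≡ 3 (mod 4)` for an imaginary quadratic field with odd `d_K` (a fundamental discriminant
is `≡ 1 (mod 4)` or divisible by `4`). [folklore] -/
theorem natAbs_discr_mod_four : (NumberField.discr K).natAbs % 4 = 3 := by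
  have h4 : NumberField.discr K = 4 * (NumberField.discr K / 4) + 1 := by
    rcases Quadratic.isFundamentalDiscriminant_discr (K := K) hK.1 with ⟨h1, -, -⟩ | ⟨h4, -, -⟩
    · omega
    · exfalso
      obtain ⟨k, hk⟩ := h4
      obtain ⟨m, hm⟩ := hodd
      omega
  have hneg : NumberField.discr K < 0 := hK.discr_neg
  have h := discr_eq_neg_natAbs K hK
  omega

include hK hodd in
/-- **`q* = d_K`**: for an imaginary quadratic field with odd `d_K` and `q = |d_K|`,
`(−1)^{⌊q/2⌋} · q = d_K` (`q ≡ 3 (mod 4)`, so the sign is `−1`). [folklore] -/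
theorem pStar_natAbs_discr_eq :
    (-1 : ℤ) ^ ((NumberField.discr K).natAbs / 2) * (NumberField.discr K).natAbs = NumberField.discr K := by
  set q : ℕ := (NumberField.discr K).natAbs with hq
  have h3 : q % 4 = 3 := natAbs_discr_mod_four K hK hodd
  have hodd2 : Odd (q / 2) := ⟨q / 4, by omega⟩
  rw [hodd2.neg_one_pow, discr_eq_neg_natAbs K hK]
  ring

end Discr

/-- **The globally minimal model of the Heegner twist on a prime Heegner field.** `W/ℚ` globally
minimal; `K` imaginary quadratic with `d_K` odd, `q = |d_K|` prime, satisfying the Heegner hypothesis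
for the conductor of `W` (so `q`, being ramified, does not divide `N`: `W` is good at `q`). Then the
twist `W^{(d_K)}` has a globally minimal `ℚ`-model `Wd = Cd • W^{(d_K)}` with `|u(Cd)| = 1` — the
tree's integral twist model by `q* = d_K` (`isGloballyMinimal_twistModel_pStar`,
`exists_variableChange_twistModel_eq_quadraticTwist`). [cite: Stevens1989, Lemma (5.2) p. 96 (sketch of proof)]
[cite: SilvermanAEC2009, VII.1 Remark 1.1 and Prop. 1.3, X.5 Cor. 5.4] -/
theorem exists_isGloballyMinimal_twist_of_prime_discr (W : WeierstrassCurve ℚ) [W.IsElliptic]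
    [W.IsGloballyMinimal] (K : Type) [Field K] [NumberField K] (hK : IsImaginaryQuadratic K)
    (hodd : Odd (NumberField.discr K)) (hH : SatisfiesHeegnerHypothesis (W.conductorNorm ℤ) K)
    (hq : (NumberField.discr K).natAbs.Prime) :
    ∃ (Wd : WeierstrassCurve ℚ) (Cd : VariableChange ℚ),
      Cd • W.quadraticTwist (NumberField.discr K : ℚ) = Wd ∧ |(Cd.u : ℚ)| = 1 ∧
        Wd.IsElliptic ∧ Wd.IsGloballyMinimal := by
  set q : ℕ := (NumberField.discr K).natAbs with hq_def
  haveI : Fact q.Prime := ⟨hq⟩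
  have hd0 : (NumberField.discr K : ℚ) ≠ 0 := by exact_mod_cast NumberField.discr_ne_zero K
  haveI : (W.quadraticTwist (NumberField.discr K : ℚ)).IsElliptic := W.isElliptic_quadraticTwist hd0
  -- `q` is odd, ramified, `q ∤ N`, `W` good at `q`
  have hqd : (q : ℤ) ∣ NumberField.discr K := by
    rw [hq_def]; exact Int.natAbs_dvd.mpr (dvd_refl _)
  have hq2 : q ≠ 2 := by
    intro h
    obtain ⟨m, hm⟩ := hodd
    have h2 : (2 : ℤ) ∣ NumberField.discr K := by
      have := hqd
      rw [h] at this
      exact_mod_cast this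
    omega
  have hqN : ¬ q ∣ W.conductorNorm ℤ := by
    intro hqN
    refine not_dvd_discr_of_split hK hq hq2 (fun p hp hpq => ?_) hqd
    rw [(Nat.prime_dvd_prime_iff_eq hp hq).mp hpq]
    exact hH q hq hqN
  have hgood : W.HasGoodReductionAtPrime q := by
    by_contra h
    exact hqN ((W.dvd_conductorNorm_iff_not_hasGoodReductionAtPrime q).mpr h)
  -- the twist model by `q* = d_K`
  set k : ℤ := ((-1 : ℤ) ^ (q / 2) * q - 1) / 4 with hk
  have hmin := isGloballyMinimal_twistModel_pStar W hq2 (Or.inl hgood)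
  have h4 : (4 : ℤ) ∣ (-1 : ℤ) ^ (q / 2) * q - 1 := four_dvd_pStar_sub_one (p := q) hq2
  have h4k : (4 : ℤ) * k + 1 = NumberField.discr K := by
    rw [← pStar_natAbs_discr_eq K hK hodd, ← hq_def, hk]
    have := Int.ediv_mul_cancel h4
    linarith
  have h4kℚ : (4 : ℚ) * ((k : ℤ) : ℚ) + 1 = (NumberField.discr K : ℚ) := by exact_mod_cast h4k
  obtain ⟨C, hCu, hC⟩ := exists_variableChange_twistModel_eq_quadraticTwist W ((k : ℤ) : ℚ)
  rw [h4kℚ] at hC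
  refine ⟨W.twistModel ((k : ℤ) : ℚ), C⁻¹, ?_, ?_, ?_, hmin⟩
  · rw [← hC, inv_smul_smul]
  · have : (C⁻¹.u : ℚ) = ((C.u : ℚ))⁻¹ := by rw [VariableChange.inv_def]; simp
    rw [this, hCu]; simp
  · have h : W.twistModel ((k : ℤ) : ℚ) = C⁻¹ • W.quadraticTwist (NumberField.discr K : ℚ) := by
      rw [← hC, inv_smul_smul]
    rw [h]; infer_instance

end Summit.BirchSwinnertonDyer.BirchSwinnertonDyer.Theorems.ShaCountTwo

end
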